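import Mathlib.FieldTheory.KummerExtension
import HarnessLib

/-!
# Irreducibility of `Xⁿ − a` for all `n` over fields in which `−1` is a square

Mathlib (`Mathlib.FieldTheory.KummerExtension`) proves the classical criterion
"`Xⁿ − a` is irreducible iff `a` is not a `p`-th power for every prime `p ∣ n`" only for odd `n`
(`X_pow_sub_C_irreducible_iff_forall_prime_of_odd`; "TODO: generalize to even `n`"). For even
`n` the criterion needs the extra Capelli–Vahlen condition `a ∉ −4K⁴` when `4 ∣ n`
(Lang, *Algebra*, VI §9, Thm 9.1). When `−1` is a square in `K` — in particular when `K` contains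
a primitive `4`-th root of unity, as do all fields containing all roots of unity (the setting of
Kummer theory of finite rank used for Bays–Kirby 2018, Prop. 3.22/3.24) — the extra condition is
automatic and the odd-`n` proof goes through verbatim: in the inductive step the norm of a root
`x` of `Xᵖ − a` is `(−1)ᵖ(−a) = ±a`, and a `q`-th root of the sign `±1` exists in `K`
(`1`, `−1` for `q` odd, `i` for `q = 2`).

* `Literature.FieldTheory.Kummer.X_pow_sub_C_irreducible_of_isSquare_neg_one` — if `−1` is a square in `K` and `a` is not a
  `p`-th power in `K` for every prime `p ∣ n` (`n ≠ 0`), then `Xⁿ − C a` is irreducible;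
* `Literature.FieldTheory.Kummer.X_pow_sub_C_irreducible_iff_forall_prime_of_isSquare_neg_one` — the criterion as an iff.

## References

* S. Lang, *Algebra*, 3rd ed., GTM 211, Springer 2002, Ch. VI §9, Thm 9.1.
-/

namespace Literature.FieldTheory.Kummer

open Polynomial IntermediateField

universe u

variable {K : Type u} [Field K]

/-- **`Xⁿ − a` is irreducible when `a` is not a `p`-th power for any prime `p ∣ n`, provided `−1`
is a square in `K`** (Lang, *Algebra* VI §9 Thm 9.1, in the case `√−1 ∈ K` where the condition
`a ∉ −4K⁴` is implied by `a ∉ K²`). Proof as in Mathlib's `X_pow_sub_C_irreducible_of_odd`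
(induction on the prime factorisation via `X_pow_mul_sub_C_irreducible` and norms), the sign
`(−1)ᵖ` of the norm being absorbed by a `q`-th root of `±1`. [cite: Lang2002, VI §9 Thm 9.1] -/
theorem X_pow_sub_C_irreducible_of_isSquare_neg_one {n : ℕ} (hn : n ≠ 0)
    (hi : ∃ i : K, i ^ 2 = -1) {a : K}
    (ha : ∀ p : ℕ, p.Prime → p ∣ n → ∀ b : K, b ^ p ≠ a) :
    Irreducible (X ^ n - C a) := by
  induction n using induction_on_primes generalizing K a with
  | zero => exact (hn rfl).elim
  | one => simpa using irreducible_X_sub_C a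
  | prime_mul p n hp IH =>
    have hn0 : n ≠ 0 := fun h => hn (by rw [h, mul_zero])
    rw [mul_comm]
    apply X_pow_mul_sub_C_irreducible
      (X_pow_sub_C_irreducible_of_prime hp (ha p hp (dvd_mul_right _ _)))
    intro E _ _ x hx
    have hint : IsIntegral K x := not_not.mp fun h ↦ by
      simpa only [degree_zero, degree_X_pow_sub_C hp.pos,
        WithBot.natCast_ne_bot] using congr_arg degree (hx.symm.trans (dif_neg h))
    obtain ⟨i, hi2⟩ := hi
    apply IH hn0 ⟨algebraMap K _ i, by rw [← map_pow, hi2, map_neg, map_one]⟩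
    intro q hq hqn b hb
    -- the norm of `b ^ q = gen x` is `(-1) ^ p * (-a)`
    have hnorm : (Algebra.norm K b) ^ q = (-1) ^ p * -a := by
      rw [← map_pow, hb, ← adjoin.powerBasis_gen hint,
        Algebra.PowerBasis.norm_gen_eq_coeff_zero_minpoly]
      simp [minpoly_gen, hx, hp.ne_zero.symm]
    -- a `q`-th root `t` of the sign `s = (-1) ^ (p + 1)` exists in `K`
    have hsign : ∃ t : K, t ^ q = (-1) ^ (p + 1) := by
      rcases Nat.even_or_odd (p + 1) with he | ho
      · exact ⟨1, by rw [one_pow, he.neg_one_pow]⟩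
      · rw [ho.neg_one_pow]
        rcases hq.eq_two_or_odd' with rfl | hqo
        · exact ⟨i, hi2⟩
        · exact ⟨-1, hqo.neg_one_pow⟩
    obtain ⟨t, ht⟩ := hsign
    refine ha q hq (dvd_mul_of_dvd_right hqn p) (t * Algebra.norm K b) ?_
    rw [mul_pow, ht, hnorm, ← mul_assoc, ← pow_add, show p + 1 + p = 2 * p + 1 by ring,
      pow_succ, pow_mul, neg_one_sq, one_pow, one_mul, neg_one_mul, neg_neg]

/-- **Criterion** (iff form): over a field in which `−1` is a square, for `n ≠ 0`, `Xⁿ − C a` is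
irreducible iff `a` is not a `p`-th power for any prime `p ∣ n`. [cite: Lang2002, VI §9 Thm 9.1] -/
theorem X_pow_sub_C_irreducible_iff_forall_prime_of_isSquare_neg_one {n : ℕ} (hn : n ≠ 0)
    (hi : ∃ i : K, i ^ 2 = -1) {a : K} :
    Irreducible (X ^ n - C a) ↔ ∀ p : ℕ, p.Prime → p ∣ n → ∀ b : K, b ^ p ≠ a :=
  ⟨fun e _ hp hpn ↦ pow_ne_of_irreducible_X_pow_sub_C e hpn hp.ne_one,
    X_pow_sub_C_irreducible_of_isSquare_neg_one hn hi⟩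

end Literature.FieldTheory.Kummer
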